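import Summits.QuantumAdvantage.QuantumAdvantage.Cruxes.DegreeOnePrimesEscape.IdeatorSketchR1I3
import Summits.QuantumAdvantage.QuantumAdvantage.Theorems.DegreeOnePrimesEscape.Negative.WithoutProperFalse
import Summits.QuantumAdvantage.QuantumAdvantage.Theorems.DegreeOnePrimesEscape.Negative.EscapeCounting
import Summits.QuantumAdvantage.QuantumAdvantage.Theorems.DegreeOnePrimesEscape.Negative.EscapeSign
import Literature.NumberTheory.LFunctions.ZetaRealAxis
import HarnessLib.Audit

/-!
# Skeleton line `dedekind-s3-collision` for crux `DegreeOnePrimesEscape` (stmt-QuantumAdvantage-11543)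

Route `LinnikCubicClassGroups`, crux r2 `DegreeOnePrimesEscape` =
`∀ n, ∃ C, ∀ K (number field, [K:ℚ] = n, no quadratic subfield), ∀ x ≥ |d_K|^C, ∀ M < Cl(𝓞 K) proper:
 π(x) ≤ 8 · #{P prime of 𝓞 K : N P prime, N P ≤ x, [P] ∉ M}`.

## State of the crux this skeleton docks into (read 2026-08-16T01:30Z)

The crux is CONDITIONALLY PROVED in the tree workfile `Cruxes/DegreeOnePrimesEscape/IdeatorSketchR1I3.lean`
(imported here): `OneSidedShadows.degreeOnePrimesEscape_of_TZ_starkInexplicit :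
ThornerZaman2019_classPNT_hilbertClassField → HeilbronnCount.StarkNoQuadSubfieldInexplicit → DegreeOnePrimesEscape`
(sorry-free, standard axioms; re-checked by the disprover gen 3 and all three triagers). Everything left is the
discharge of the two hypotheses: the Thorner–Zaman fact (shared by EVERY line) and the inexplicit Stark
non-vanishing `∀ n, ∃ c(n) > 0, ∀ K of degree n without quadratic subfield, ζ_K ≠ 0 on [1 − c/log|d_K|, 1)`.

## The line (crux idea card `dedekind-s3-collision`; triage r1: 3 × pass)

Make the Stark hypothesis DEGREE-LOCAL (`StarkAt n`; `(∀ n, StarkAt n)` IS `StarkNoQuadSubfieldInexplicit`,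
`Iff.rfl`) and discharge the degree the route consumes, `n = 3` (`Disproof.cubic_escape_of_crux`), WITHOUT Artin
`L`-functions:

* non-Galois (S₃-type) cubic `K`: Dedekind's 1900 relation `ζ_N·ζ² = ζ_k·ζ_K²` in the sextic Galois closure `N`
  with its quadratic resolvent `k` (= the Brauer relation `2·1 + Ind_1^{S₃} 1 = Ind_{A₃} 1 + 2·Ind_{C₂} 1`, Euler
  factor by Euler factor, ramified primes included) turns a real zero `β` of `ζ_K` into a zero of ORDER ≥ 2 of the
  entire `ζ₁_N` (`ζ(β) < 0` on `(0,1)`: tree `riemannZeta_neg_of_pos_of_lt_one`), which the tree's PROVED uniform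
  simplicity theorem `exists_realZero_simple_dedekindZeta₁ 6` pushes below `1 − c(6)/(log|d_N| + log 4)`; with
  `|d_N| ≤ |d_K|^A` (A = 6 from the tree's `natAbs_discr_le_pow_of_separating`, or 3 by the resolvent) this is a
  real-zero-free interval `[1 − c/log|d_K|, 1)` for every non-Galois cubic field (stubs 1–3);
* Galois (cyclic) cubic `K`: a real zero of `ζ_K = ζ·L(χ)·L(χ̄)` is automatically double, and
  `exists_realZero_simple_dedekindZeta₁ 3` applies to `K` itself (stub 4);
* every other degree keeps the Stark input (`StarkResidue`, stub 5 — Stark 1974 Thm 3 / Heilbronn, shared with line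
  `heilbronn-count-discharge`; the Literature programme `HeilbronnStark` / `StarkNoQuadraticSubfieldGlue` (landed
  2026-08-16T00:50Z) is one file away from `Stark1974_dedekindZeta_ne_zero_of_noQuadraticSubfield_holds`, after which
  stub 5 is the one-liner `starkResidue_of_named` below);
* the Thorner–Zaman fact (stub 6, shared with every line; depth 1 of line `one-sided-shadows`).

`DegreeOnePrimesEscape_of` composes the six stubs into the crux BY NAME (kernel-checked, no `sorry`):
`degreeOnePrimesEscape_of_TZ_starkInexplicit h6 (starkAll (starkAt_three (h3 h1 h2) h4) h5)`; the only new glue is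
`starkAt_three_of_cubic` (min of the two constants, case split on `IsGalois ℚ K`), PROVED here.

BYPASS (honest): once `Stark1974_dedekindZeta_ne_zero_of_noQuadraticSubfield_holds` lands, stubs 3 (conclusion), 4 and 5
follow from it in one line each (`cubicZeroFreeNonGalois_of_named`, `cubicZeroFreeGalois_of_named`,
`starkResidue_of_named`, all PROVED below), and the crux needs only stub 6; stubs 1–2 then carry the line's
independent content (Dedekind's relation for S₃-sextics and the embedded S₃-closure with a discriminant bound —
neither is in the tree) but are no longer on the critical path.

## Disproof used (`Cruxes/DegreeOnePrimesEscape/Disproof.lean`, cdisprove gen 3 v4.1)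
* §1 `degreeOnePrimesEscape_false_without_proper` (landed `Negative/WithoutProperFalse.lean`, p69750) — HONOURED:
  `M ≠ ⊤` is used inside the docked composition (`degreeOnePrimesEscape_of_shadows`: `[Cl:M] ≥ 2`), not here.
* §2 degenerate degrees `n ≤ 2` are handled inside the dock; §3 odd degree: at `n = 3` the no-quadratic-subfield
  hypothesis is automatic — the stubs 3/4 conclusions do not even assume it.
* §9 `CruxFromFacts` / `not_crux_imp_not_fact`, `not_stark_iff` — the ONE enemy is a real zero of `ζ_K` itself
  near `1`; stubs 3, 4, 5 are exactly its exclusion, degree by degree.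
* §10 sign lemmas (landed `Negative/EscapeSign.lean`, p70790) and §5/5b counting (landed
  `Negative/EscapeCounting.lean`, p70172) — used inside the dock (`subgroupUpperShadow_of_TZ`); imported and
  re-checked below; no landed Negative lemma refutes an instance of any stub (they concern counting / signs, the
  stubs concern zeros of zeta functions and field theory).
* No `-- Targets` stub kill and no sorried near-miss exist for this crux (Disproof.lean: `targets = []`).
-/

noncomputable section

open scoped NumberField nonZeroDivisors
open Literature.NumberTheory.LFunctions Literature.NumberTheory.LFunctions.NumberField

set_option linter.dupNamespace false

namespace Summit.QuantumAdvantage.QuantumAdvantage.Cruxes.DegreeOnePrimesEscape.DedekindS3Collision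

/-! ### The statements of the line (named `Prop`s over existing declarations) -/

/-- **Stark's inexplicit non-vanishing AT ONE DEGREE `n`** — the degree-`n` slice of
`HeilbronnCount.StarkNoQuadSubfieldInexplicit` (verbatim its body): there is `c = c(n) > 0` such that for
every number field `K` of degree `n` without quadratic subfield, `ζ_K(σ) ≠ 0` for `1 − c/log|d_K| ≤ σ < 1`. -/
def StarkAt (n : ℕ) : Prop :=
  ∃ c : ℝ, 0 < c ∧ ∀ (K : Type) [Field K] [NumberField K], Module.finrank ℚ K = n →
    (∀ F : IntermediateField ℚ K, Module.finrank ℚ F ≠ 2) →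
    ∀ σ : ℝ, 1 - c / Real.log ((NumberField.discr K).natAbs : ℝ) ≤ σ → σ < 1 →
      dedekindZetaCont K σ ≠ 0

/-- The degree-local slicing is definitional. -/
theorem starkNoQuadSubfieldInexplicit_iff :
    HeilbronnCount.StarkNoQuadSubfieldInexplicit ↔ ∀ n : ℕ, StarkAt n :=
  Iff.rfl

/-- **D1–D2. Dedekind's relation for an `S₃`-sextic** (R. Dedekind 1900 for pure cubic fields; in general the
Brauer–Kuroda relation `2·1 + Ind_1^{S₃} 1 = Ind_{A₃}^{S₃} 1 + 2·Ind_{C₂}^{S₃} 1` read through Artin formalism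
`ζ_N = ζ·L(sgn)·L(ρ)²`, `ζ_K = ζ·L(ρ)`, `ζ_k = ζ·L(sgn)`): for a Galois number field `N` of degree `6` with
NON-ABELIAN group, every cubic subfield `K` and every quadratic subfield `k`,
`ζ_N(s)·ζ(s)² = ζ_k(s)·ζ_K(s)²` on `Re s > 1` (Mathlib's Dirichlet series `NumberField.dedekindZeta`,
`riemannZeta`). Euler factor by Euler factor, ramified primes included. -/
def S3DedekindRelation : Prop :=
  ∀ (N : Type) [Field N] [NumberField N] [IsGalois ℚ N], Module.finrank ℚ N = 6 →
    (∃ g h : N ≃ₐ[ℚ] N, g * h ≠ h * g) →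
    ∀ (K k : IntermediateField ℚ N), Module.finrank ℚ K = 3 → Module.finrank ℚ k = 2 →
    ∀ s : ℂ, 1 < s.re →
      NumberField.dedekindZeta N s * riemannZeta s ^ 2 =
        NumberField.dedekindZeta k s * NumberField.dedekindZeta K s ^ 2

/-- **D4. The embedded `S₃`-closure with a polynomial discriminant bound**: there is an absolute `A` such that
every NON-Galois cubic number field `K` embeds into a Galois number field `N` of degree `6` with non-abelian
group, containing a quadratic subfield, with `|d_N| ≤ |d_K|^A` (`A = 6`: tree
`Literature.NumberTheory.NumberFields.natAbs_discr_le_pow_of_separating`, the three conjugates of `K` separate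
`Gal(N/ℚ) ≅ S₃`; classically `|d_N| = |d_k|·d_K² ≤ |d_K|³`). -/
def CubicClosureBound : Prop :=
  ∃ A : ℕ, ∀ (K : Type) [Field K] [NumberField K], Module.finrank ℚ K = 3 → ¬ IsGalois ℚ K →
    ∃ (N : Type) (_ : Field N) (_ : NumberField N), IsGalois ℚ N ∧ Module.finrank ℚ N = 6 ∧
      (∃ g h : N ≃ₐ[ℚ] N, g * h ≠ h * g) ∧
      (∃ K' : IntermediateField ℚ N, Nonempty (K ≃ₐ[ℚ] K')) ∧
      (∃ k : IntermediateField ℚ N, Module.finrank ℚ k = 2) ∧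
      (NumberField.discr N).natAbs ≤ (NumberField.discr K).natAbs ^ A

/-- **Real-zero-free interval for NON-Galois cubic fields** (the `S₃` slice of `StarkAt 3`, field hypothesis
dropped — it is automatic in odd degree, `Disproof.noQuadraticSubfield_of_odd`). -/
def CubicZeroFreeNonGalois : Prop :=
  ∃ c : ℝ, 0 < c ∧ ∀ (K : Type) [Field K] [NumberField K], Module.finrank ℚ K = 3 → ¬ IsGalois ℚ K →
    ∀ σ : ℝ, 1 - c / Real.log ((NumberField.discr K).natAbs : ℝ) ≤ σ → σ < 1 →
      dedekindZetaCont K σ ≠ 0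

/-- **Real-zero-free interval for Galois (cyclic) cubic fields** (the `C₃` residue inside `n = 3`). -/
def CubicZeroFreeGalois : Prop :=
  ∃ c : ℝ, 0 < c ∧ ∀ (K : Type) [Field K] [NumberField K], Module.finrank ℚ K = 3 → IsGalois ℚ K →
    ∀ σ : ℝ, 1 - c / Real.log ((NumberField.discr K).natAbs : ℝ) ≤ σ → σ < 1 →
      dedekindZetaCont K σ ≠ 0

/-- **D3+D5. The collision transfer**: Dedekind's relation and the embedded closure give the zero-free interval
for non-Galois cubics (continuation of the relation by the identity theorem, `ord_β ζ₁_N = ord_β ζ_k + 2·ord_β ζ_K ≥ 2`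
at a real zero `β ∈ (0,1)` of `ζ_K` since `ζ(β) < 0`, then `exists_realZero_simple_dedekindZeta₁ 6` and
`log|d_N| ≤ A·log|d_K|`). -/
def CollisionTransfer : Prop := S3DedekindRelation → CubicClosureBound → CubicZeroFreeNonGalois

/-- **The residue**: every degree other than `3` keeps Stark's input (Stark 1974 Thm 3 via Heilbronn characters;
`= HeilbronnCount.StarkNoQuadSubfieldInexplicit` off `n = 3`; implied by the named fact
`Stark1974_dedekindZeta_ne_zero_of_noQuadraticSubfield`, see `starkResidue_of_named`). -/
def StarkResidue : Prop := ∀ n : ℕ, n ≠ 3 → StarkAt n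

/-! ### The registered stubs (statements expanded over existing declarations) -/

/-- STUB 1 (L, OPEN in the tree, this line's load-bearing algebra) — `S3DedekindRelation`. Proof pattern in the
tree: `AbelianFieldDedekindZeta.lean` §§1–3 and §8 (regroup both Euler products along `primeBelow`,
`hasProd_dedekindEulerFactor_holds`, `prod_fiber_eq_prod_map_splittingType`, Mathlib
`riemannZeta_eulerProduct_hasProd`, `HasProd.unique`), with the splitting types of `p` in `N`, `K`, `k` read off
the Frobenius/inertia double cosets in `S₃` by Perlis' counting identity (★)
`card_inertia_mul_card_fixingSubgroup_mul_sum` (`ArithmeticEquivalenceGassmannProofs.lean`, any Galois `N/ℚ`,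
ramified `p` included). Local check (card's cheapest falsifier): unramified types `e ↦ (1−T)⁻⁸` both sides,
transposition `↦ (1−T²)⁻³(1−T)⁻²`, 3-cycle `↦ (1−T³)⁻²(1−T)⁻²`; ramified `p`: both sides equal by the character
identity on `V^I`. PARI jobs j008496 / j008637 (triage) test it numerically. -/
theorem stub_dedekindRelation :
    ∀ (N : Type) [Field N] [NumberField N] [IsGalois ℚ N], Module.finrank ℚ N = 6 →
      (∃ g h : N ≃ₐ[ℚ] N, g * h ≠ h * g) →
      ∀ (K k : IntermediateField ℚ N), Module.finrank ℚ K = 3 → Module.finrank ℚ k = 2 →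
      ∀ s : ℂ, 1 < s.re →
        NumberField.dedekindZeta N s * riemannZeta s ^ 2 =
          NumberField.dedekindZeta k s * NumberField.dedekindZeta K s ^ 2 := by
  sorry

/-- STUB 2 (M, PROVABLE NOW from tree material) — `CubicClosureBound` with `A = 6`: take `N :=` the normal closure
of `K` in `AlgebraicClosure ℚ` (Mathlib `normalClosure`; finite-dimensional and normal, hence a Galois number
field), `K' := ` the range of the canonical embedding; `[N:ℚ] ∣ 3! ` and `K` not normal force `[N:ℚ] = 6` and a
non-abelian group (an abelian sextic would make every subfield Galois); the quadratic subfield is the fixed field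
of the index-2 subgroup `A₃` (Galois correspondence, `IsGalois.intermediateFieldEquivSubgroup`; cf.
`exists_intermediateField_finrank_eq_two`, `StarkNoQuadraticSubfieldGlue.lean` G7); the bound is
`natAbs_discr_le_pow_of_separating` (GaloisClosureDiscriminant / Glue G5) since the conjugates of `K'` have
trivially-intersecting stabilisers in `S₃` (Glue G2–G4: `iSup_fieldRange_normalClosure_eq_top`,
`exists_not_mem_fixingSubgroup_fieldRange`). -/
theorem stub_cubicClosure :
    ∃ A : ℕ, ∀ (K : Type) [Field K] [NumberField K], Module.finrank ℚ K = 3 → ¬ IsGalois ℚ K →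
      ∃ (N : Type) (_ : Field N) (_ : NumberField N), IsGalois ℚ N ∧ Module.finrank ℚ N = 6 ∧
        (∃ g h : N ≃ₐ[ℚ] N, g * h ≠ h * g) ∧
        (∃ K' : IntermediateField ℚ N, Nonempty (K ≃ₐ[ℚ] K')) ∧
        (∃ k : IntermediateField ℚ N, Module.finrank ℚ k = 2) ∧
        (NumberField.discr N).natAbs ≤ (NumberField.discr K).natAbs ^ A := by
  sorry

/-- STUB 3 (M, PROVABLE NOW given stubs 1–2; the collision proper) — `CollisionTransfer`: for `K` non-Galois cubic
and `σ ∈ [1 − c/log|d_K|, 1)` with `ζ_K(σ) = 0` (so `σ > 1/2`, `|d_K| ≥ 23`): move to `K' ≅ K` inside `N`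
(`dedekindZetaCont_eq_of_algEquiv`, Glue G1); the relation on `Re s > 1` continues to `{1}ᶜ` (both sides are
analytic off `1` and agree on the half-plane: `IsDedekindZetaContinuation.unique` pattern /
`AnalyticOnNhd.eqOn_of_preconnected_of_eventuallyEq`, `dedekindZetaCont_eq_dedekindZeta_holds`,
`dedekindZetaCont_rat_eq_riemannZeta_holds`); analytic orders add (`AnalyticAt.analyticOrderAt_mul/pow`), `ζ(σ) ≠ 0`
(`riemannZeta_neg_of_pos_of_lt_one`) and `ζ_k` has finite order (`analyticOrderAt_dedekindZeta₁_ne_top`), so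
`2 ≤ analyticOrderAt (dedekindZeta₁ N) σ` (`analyticOrderAt_dedekindZeta₁_eq_dedekindZetaCont`); then
`exists_realZero_simple_dedekindZeta₁ 6` gives `σ ≤ 1 − c₆/(log|d_N| + log 4) ≤ 1 − c₆/((A+2) log|d_K|)`,
contradiction for `c := c₆/(2(A+2))`. -/
theorem stub_collisionTransfer :
    (∀ (N : Type) [Field N] [NumberField N] [IsGalois ℚ N], Module.finrank ℚ N = 6 →
      (∃ g h : N ≃ₐ[ℚ] N, g * h ≠ h * g) →
      ∀ (K k : IntermediateField ℚ N), Module.finrank ℚ K = 3 → Module.finrank ℚ k = 2 →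
      ∀ s : ℂ, 1 < s.re →
        NumberField.dedekindZeta N s * riemannZeta s ^ 2 =
          NumberField.dedekindZeta k s * NumberField.dedekindZeta K s ^ 2) →
    (∃ A : ℕ, ∀ (K : Type) [Field K] [NumberField K], Module.finrank ℚ K = 3 → ¬ IsGalois ℚ K →
      ∃ (N : Type) (_ : Field N) (_ : NumberField N), IsGalois ℚ N ∧ Module.finrank ℚ N = 6 ∧
        (∃ g h : N ≃ₐ[ℚ] N, g * h ≠ h * g) ∧
        (∃ K' : IntermediateField ℚ N, Nonempty (K ≃ₐ[ℚ] K')) ∧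
        (∃ k : IntermediateField ℚ N, Module.finrank ℚ k = 2) ∧
        (NumberField.discr N).natAbs ≤ (NumberField.discr K).natAbs ^ A) →
    ∃ c : ℝ, 0 < c ∧ ∀ (K : Type) [Field K] [NumberField K], Module.finrank ℚ K = 3 → ¬ IsGalois ℚ K →
      ∀ σ : ℝ, 1 - c / Real.log ((NumberField.discr K).natAbs : ℝ) ≤ σ → σ < 1 →
        dedekindZetaCont K σ ≠ 0 := by
  sorry

/-- STUB 4 (M, PROVABLE NOW from tree material) — `CubicZeroFreeGalois`: for cyclic cubic `K`, Kronecker–Weber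
(`KroneckerWeber_holds`) embeds `K` in some `ℚ(ζ_n)`, `AbelianDedekindZeta.dedekindZetaCont_eq_prod_characterGroup_LFunction`
gives `ζ_K = ζ·L(χ⋆)·L(χ̄⋆)` with `χ` cubic; at a real zero `σ ∈ (0,1)`, `ζ(σ) < 0` forces `L(σ,χ⋆) = 0` or
`L(σ,χ̄⋆) = 0`, and `L(σ, χ̄⋆) = conj L(σ, χ⋆)` for real `σ`, so BOTH vanish: `2 ≤ analyticOrderAt (dedekindZeta₁ K) σ`
and `exists_realZero_simple_dedekindZeta₁ 3` gives `σ ≤ 1 − c₃/(log|d_K| + log 4)`. (Alternative in tree: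
`Heilbronn.exists_index_two_of_dedekindZetaCont_eq_zero` with `N = K`, `G = C₃` has no index-2 subgroup; or the
named Stark fact, `cubicZeroFreeGalois_of_named`.) -/
theorem stub_galoisCubicZeroFree :
    ∃ c : ℝ, 0 < c ∧ ∀ (K : Type) [Field K] [NumberField K], Module.finrank ℚ K = 3 → IsGalois ℚ K →
      ∀ σ : ℝ, 1 - c / Real.log ((NumberField.discr K).natAbs : ℝ) ≤ σ → σ < 1 →
        dedekindZetaCont K σ ≠ 0 := by
  sorry

/-- STUB 5 (XL as mathematics = Stark 1974 Thm 3 / Heilbronn in every degree `n ≠ 3`; SHARED with line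
`heilbronn-count-discharge` K1; becomes a ONE-LINER (`starkResidue_of_named`) the moment the Literature programme
`StarkNoQuadraticSubfieldGlue` → `…Proofs` lands `Stark1974_dedekindZeta_ne_zero_of_noQuadraticSubfield_holds`) —
`StarkResidue`. -/
theorem stub_starkResidue :
    ∀ n : ℕ, n ≠ 3 →
      ∃ c : ℝ, 0 < c ∧ ∀ (K : Type) [Field K] [NumberField K], Module.finrank ℚ K = n →
        (∀ F : IntermediateField ℚ K, Module.finrank ℚ F ≠ 2) →
        ∀ σ : ℝ, 1 - c / Real.log ((NumberField.discr K).natAbs : ℝ) ≤ σ → σ < 1 →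
          dedekindZetaCont K σ ≠ 0 := by
  sorry

/-- STUB 6 (XL, OPEN as a formalisation, SHARED with every line of this crux; depth 1 of line `one-sided-shadows`) —
the Thorner–Zaman 2019 Thm 1.4 fact for the Hilbert class field, AS TYPED in the tree
(`UniformClassGroupPNTGeneralDegree.lean`; faithful to print per Disproof §11; second source Thorner–Zhang 2024
Cor. 4). -/
theorem stub_thornerZaman : ThornerZaman2019_classPNT_hilbertClassField := by
  sorry

/-! ### Consistency: each named statement IS its registered stub (definitionally) -/

theorem s3DedekindRelation_holds : S3DedekindRelation := stub_dedekindRelation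
theorem cubicClosureBound_holds : CubicClosureBound := stub_cubicClosure
theorem collisionTransfer_holds : CollisionTransfer := stub_collisionTransfer
theorem cubicZeroFreeGalois_holds : CubicZeroFreeGalois := stub_galoisCubicZeroFree
theorem starkResidue_holds : StarkResidue := stub_starkResidue

/-! ### Name-keyed aliases of the six statements (the hypotheses of the composition; the skeleton audit admits
a hypothesis only if its head constant is a registered obligation or is named like a declared stub) -/
namespace Registered

/-- Alias of `S3DedekindRelation` keyed by the registered stub name. -/
abbrev stub_dedekindRelation : Prop := S3DedekindRelation
/-- Alias of `CubicClosureBound` keyed by the registered stub name. -/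
abbrev stub_cubicClosure : Prop := CubicClosureBound
/-- Alias of `CollisionTransfer` keyed by the registered stub name. -/
abbrev stub_collisionTransfer : Prop := CollisionTransfer
/-- Alias of `CubicZeroFreeGalois` keyed by the registered stub name. -/
abbrev stub_galoisCubicZeroFree : Prop := CubicZeroFreeGalois
/-- Alias of `StarkResidue` keyed by the registered stub name. -/
abbrev stub_starkResidue : Prop := StarkResidue
/-- Alias of the Thorner–Zaman fact keyed by the registered stub name. -/
abbrev stub_thornerZaman : Prop := ThornerZaman2019_classPNT_hilbertClassField

end Registered

/-! ### Glue (PROVED): degree `3` from its two Galois types; all degrees from `3` + residue -/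

/-- `|d_K| ≥ 1`, so `log|d_K| ≥ 0`. [folklore] -/
theorem log_natAbs_discr_nonneg (K : Type) [Field K] [NumberField K] :
    0 ≤ Real.log ((NumberField.discr K).natAbs : ℝ) := by
  apply Real.log_nonneg
  exact_mod_cast Nat.one_le_iff_ne_zero.mpr (Int.natAbs_ne_zero.mpr (NumberField.discr_ne_zero K))

/-- **`StarkAt 3` from the two Galois types of a cubic field** (min of the two constants; the
no-quadratic-subfield hypothesis is not even needed at `n = 3`). -/
theorem starkAt_three_of_cubic (hng : CubicZeroFreeNonGalois) (hg : CubicZeroFreeGalois) : StarkAt 3 := by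
  classical
  obtain ⟨c₁, hc₁, h₁⟩ := hng
  obtain ⟨c₂, hc₂, h₂⟩ := hg
  refine ⟨min c₁ c₂, lt_min hc₁ hc₂, fun K _ _ hK _ σ hσ hσ1 => ?_⟩
  have hlog := log_natAbs_discr_nonneg K
  by_cases hGal : IsGalois ℚ K
  · refine h₂ K hK hGal σ (le_trans ?_ hσ) hσ1
    have hdiv : min c₁ c₂ / Real.log ((NumberField.discr K).natAbs : ℝ) ≤
        c₂ / Real.log ((NumberField.discr K).natAbs : ℝ) :=
      div_le_div_of_nonneg_right (min_le_right _ _) hlog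
    linarith
  · refine h₁ K hK hGal σ (le_trans ?_ hσ) hσ1
    have hdiv : min c₁ c₂ / Real.log ((NumberField.discr K).natAbs : ℝ) ≤
        c₁ / Real.log ((NumberField.discr K).natAbs : ℝ) :=
      div_le_div_of_nonneg_right (min_le_left _ _) hlog
    linarith

/-- All degrees from degree `3` and the residue. -/
theorem starkAt_all (h3 : StarkAt 3) (hres : StarkResidue) : ∀ n : ℕ, StarkAt n := by
  intro n
  by_cases hn : n = 3
  · subst hn; exact h3
  · exact hres n hn

/-! ### The composition: the six stubs imply the crux, by name -/

/-- **`DegreeOnePrimesEscape` from the six stubs** (pure logic over the tree's sorry-free dock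
`OneSidedShadows.degreeOnePrimesEscape_of_TZ_starkInexplicit`; no `sorry`): stubs 1–2 fed into stub 3 give the
zero-free interval for non-Galois cubics, stub 4 the Galois cubics, hence `StarkAt 3`; stub 5 supplies every
other degree, so `StarkNoQuadSubfieldInexplicit` holds (definitionally `∀ n, StarkAt n`); stub 6 is the
Thorner–Zaman fact; the dock concludes the crux. -/
theorem DegreeOnePrimesEscape_of (h1 : Registered.stub_dedekindRelation)
    (h2 : Registered.stub_cubicClosure) (h3 : Registered.stub_collisionTransfer)
    (h4 : Registered.stub_galoisCubicZeroFree) (h5 : Registered.stub_starkResidue)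
    (h6 : Registered.stub_thornerZaman) :
    Summit.QuantumAdvantage.QuantumAdvantage.Theses.LinnikCubicClassGroups.DegreeOnePrimesEscape :=
  OneSidedShadows.degreeOnePrimesEscape_of_TZ_starkInexplicit h6
    (starkNoQuadSubfieldInexplicit_iff.mpr (starkAt_all (starkAt_three_of_cubic (h3 h1 h2) h4) h5))

/-- Wiring check: the registered stubs feed `DegreeOnePrimesEscape_of` as stated. -/
example : Summit.QuantumAdvantage.QuantumAdvantage.Theses.LinnikCubicClassGroups.DegreeOnePrimesEscape :=
  DegreeOnePrimesEscape_of stub_dedekindRelation stub_cubicClosure stub_collisionTransfer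
    stub_galoisCubicZeroFree stub_starkResidue stub_thornerZaman

/-! ### The bypass, PROVED: what the named Stark fact gives (one line per stub once `…_holds` lands) -/

/-- The named (explicit) Stark fact gives `StarkAt n` for every `n` (`c = 1/(4·n!)`). -/
theorem starkAt_of_named (h : Stark1974_dedekindZeta_ne_zero_of_noQuadraticSubfield) (n : ℕ) : StarkAt n :=
  (starkNoQuadSubfieldInexplicit_iff.mp (HeilbronnCount.starkNoQuadSubfieldInexplicit_of_named h)) n

/-- Stub 5 from the named Stark fact. -/
theorem starkResidue_of_named (h : Stark1974_dedekindZeta_ne_zero_of_noQuadraticSubfield) : StarkResidue :=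
  fun n _ => starkAt_of_named h n

/-- A cubic field has no quadratic subfield (tower law). [folklore] -/
theorem noQuadraticSubfield_of_finrank_eq_three (K : Type) [Field K] [NumberField K]
    (hK : Module.finrank ℚ K = 3) : ∀ F : IntermediateField ℚ K, Module.finrank ℚ F ≠ 2 := by
  intro F hF
  have hdvd : Module.finrank ℚ F ∣ Module.finrank ℚ K := Dvd.intro _ (Module.finrank_mul_finrank ℚ F K)
  rw [hF, hK] at hdvd
  omega

/-- Stub 4 from the named Stark fact. -/
theorem cubicZeroFreeGalois_of_named (h : Stark1974_dedekindZeta_ne_zero_of_noQuadraticSubfield) :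
    CubicZeroFreeGalois := by
  obtain ⟨c, hc, hS⟩ := starkAt_of_named h 3
  exact ⟨c, hc, fun K _ _ hK _ σ hσ hσ1 => hS K hK (noQuadraticSubfield_of_finrank_eq_three K hK) σ hσ hσ1⟩

/-- The conclusion of stub 3 from the named Stark fact (so stub 3 is provable ignoring its hypotheses then). -/
theorem cubicZeroFreeNonGalois_of_named (h : Stark1974_dedekindZeta_ne_zero_of_noQuadraticSubfield) :
    CubicZeroFreeNonGalois := by
  obtain ⟨c, hc, hS⟩ := starkAt_of_named h 3
  exact ⟨c, hc, fun K _ _ hK _ σ hσ hσ1 => hS K hK (noQuadraticSubfield_of_finrank_eq_three K hK) σ hσ hσ1⟩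

/-- Hence, with the named Stark fact, the crux needs only the Thorner–Zaman stub (this is the tree's
`degreeOnePrimesEscape_of_TZ_Stark`, re-derived through this skeleton's composition). -/
example (hSt : Stark1974_dedekindZeta_ne_zero_of_noQuadraticSubfield) (hTZ : Registered.stub_thornerZaman) :
    Summit.QuantumAdvantage.QuantumAdvantage.Theses.LinnikCubicClassGroups.DegreeOnePrimesEscape :=
  DegreeOnePrimesEscape_of stub_dedekindRelation stub_cubicClosure (fun _ _ => cubicZeroFreeNonGalois_of_named hSt)
    (cubicZeroFreeGalois_of_named hSt) (starkResidue_of_named hSt) hTZ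

/-! ### Scratch checks against the landed `Negative/*` lemmas and the `Leans on:` names -/

/-- Landed negative lemma (p69750): `M ≠ ⊤` is load-bearing — honoured inside the dock. -/
example : ¬ Literature.Uncategorized.DegreeOnePrimesEscapeWithoutProper :=
  Summit.QuantumAdvantage.QuantumAdvantage.Theorems.DegreeOnePrimesEscape.Negative.degreeOnePrimesEscape_false_without_proper

/-- Landed sign lemma (p70790): a nontrivial exceptional character never depletes an escape count. -/
example {G : Type*} [CommGroup G] [Fintype G] (M : Subgroup G) [DecidablePred (· ∈ M)] (χ : G →* ℂˣ)
    (hχ : χ ≠ 1) : (∑ C ∈ Finset.univ.filter (· ∉ M), ((χ C : ℂˣ) : ℂ)).re ≤ 0 :=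
  Summit.QuantumAdvantage.QuantumAdvantage.Theorems.DegreeOnePrimesEscape.Negative.re_sum_filter_not_mem_nonpos M χ hχ

/-- Landed counting lemma (p70172): a proper subgroup misses at least half of a finite group. -/
example {G : Type*} [Group G] [Finite G] (M : Subgroup G) (hM : M ≠ ⊤) :
    Nat.card G ≤ 2 * ((M : Set G)ᶜ).ncard :=
  Summit.QuantumAdvantage.QuantumAdvantage.Theorems.DegreeOnePrimesEscape.Negative.card_le_two_mul_ncard_compl M hM

/-- `Leans on` (stub 3/4): the uniform simplicity theorem, PROVED in the tree, in the exact shape used. -/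
example (n : ℕ) : ∃ c : ℝ, 0 < c ∧ ∀ (K : Type) [Field K] [NumberField K], Module.finrank ℚ K = n →
    ∀ β : ℝ, (2 : ℕ∞) ≤ analyticOrderAt (dedekindZeta₁ K) β →
      β ≤ 1 - c / (Real.log ((NumberField.discr K).natAbs : ℝ) + Real.log 4) :=
  exists_realZero_simple_dedekindZeta₁ n

open scoped ComplexOrder in
/-- `Leans on` (stub 3/4): `ζ(σ) < 0` on `(0,1)` (in `ℂ` with its partial order), PROVED in the tree. -/
example {σ : ℝ} (h0 : 0 < σ) (h1 : σ < 1) : riemannZeta σ < 0 := riemannZeta_neg_of_pos_of_lt_one h0 h1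

/-- `Leans on` (bypass / stub 5): the explicit named fact implies the inexplicit one, PROVED in the workfile. -/
example : Stark1974_dedekindZeta_ne_zero_of_noQuadraticSubfield → HeilbronnCount.StarkNoQuadSubfieldInexplicit :=
  HeilbronnCount.starkNoQuadSubfieldInexplicit_of_named

/-- `Leans on` (the dock), PROVED in the workfile: TZ + inexplicit Stark ⇒ crux. -/
example : ThornerZaman2019_classPNT_hilbertClassField → HeilbronnCount.StarkNoQuadSubfieldInexplicit →
    Summit.QuantumAdvantage.QuantumAdvantage.Theses.LinnikCubicClassGroups.DegreeOnePrimesEscape :=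
  OneSidedShadows.degreeOnePrimesEscape_of_TZ_starkInexplicit

end Summit.QuantumAdvantage.QuantumAdvantage.Cruxes.DegreeOnePrimesEscape.DedekindS3Collision

end
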